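import Summits.FinalStateConjecture.FinalStateConjecture.Theorems.EIHFluxBalanceInertialRecessionRechartWhiteHoleKerrEscapePrep

/-!
# Route EIHFluxBalance — `InertialRecession`, re-charting: the ESCAPE CURVE out of a painted
# ROTATING white hole, without velocity convergence

Helper file for the crux `stmt-FinalStateConjecture-10166`
(`Summit.FinalStateConjecture.FinalStateConjecture.Theses.EIHFluxBalance.InertialRecession`),
stub `stub_rechart` of line `sublinear-is-free-clean-window-charges`.

`exists_escape_curve_spin`: for a hole of ANY spin painted with an ANTI-ORTHOCHRONOUS frame, granted
only a NORMALISED representative `Q(t)` of the painted frame modulo the Kerr–Schild stabiliser (same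
`e₀` column, same painted form and painted radius) whose drift over bounded lab-time windows tends to
zero, the slaved centre mismatch `ξ̇ᵢ − v(Λᵢ) → 0`, receding other centres, `C⁰` deviation `→ 0` and
(Ofut): at every late time the chart image of the lab segment
`σ ↦ c₀ + Λ₀(ρe₃) + (16θ/π · arctan σ) Λ₀w₀`, `Λ₀ = Q(t₀)`, `w₀ = −e₀ + ½e₃` (outgoing along the
painted SPIN AXIS at half light speed, to the rest-PAST of the painted — hence time-reversed — hole)
is a future causal curve of late guaranteed lab points from painted radius `< r₊` to `> r₊`:
exact configuration by `offset_model_eq`/`kerr_bilin_escapeConfig`, drift errors by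
`exists_kerr_escape_margin` (inverse-frame drift `norm_symm_sub_symm_le`, centre drift
`exists_centre_drift_le`), other holes by `exists_farField_bound_spin`, model value
`≤ −3/4 + 4/7 + 1/56 + 1/10 ≤ −1/20`.
[folklore; Kerr–Schild 1965; O'Neill 1983, Ch. 14]
-/

noncomputable section

set_option linter.dupNamespace false

open scoped InnerProductSpace Topology Manifold ContDiff BigOperators
open Set Function Filter Metric TopologicalSpace Literature.Geometry.Lorentzian

namespace Summit.FinalStateConjecture.FinalStateConjecture.Theorems

/-! ### The escape curve -/

section Escape

variable {𝓢 : Spacetime 4} {N : ℕ}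

-- long bookkeeping proof
set_option maxHeartbeats 3200000 in
/-- **The escape curve out of a painted rotating white hole.** See the module docstring.
[folklore] -/
theorem exists_escape_curve_spin (i : Fin N) (M a rin K : Fin N → ℝ)
    (Λ : Fin N → ℝ → lorentzGroup) (ξ : Fin N → ℝ → E3) (hM : 0 < M i)
    (hrin : rin i < Kerr.rPlus (M i) (a i)) {γ : ℝ}
    (hγb : ∀ j t, |((Λ j t : E4 ≃L[ℝ] E4) (E4.basisVector 0)) 0| ≤ γ)
    (hΛc : ∀ j, Continuous fun t ↦ ((Λ j t : E4 ≃L[ℝ] E4) : E4 →L[ℝ] E4))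
    (hξc : ∀ j, Continuous (ξ j)) (hξd : Differentiable ℝ (ξ i))
    (Q : ℝ → lorentzGroup)
    (hQ0 : ∀ t, (Q t : E4 ≃L[ℝ] E4) (E4.basisVector 0) = (Λ i t : E4 ≃L[ℝ] E4) (E4.basisVector 0))
    (hQbil : ∀ t c x, boostedKerrBilin (Λ i t) c (M i) (a i) x = boostedKerrBilin (Q t) c (M i) (a i) x)
    (hQrad : ∀ t c x, Kerr.radius (a i) (poincareInv (Λ i t) c x) =
      Kerr.radius (a i) (poincareInv (Q t) c x))
    (hQdrift : ∀ L δ : ℝ, 0 < L → 0 < δ → ∃ T : ℝ, ∀ t₀ t : ℝ, T ≤ t₀ → |t - t₀| ≤ L →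
      ‖((Q t : E4 ≃L[ℝ] E4) : E4 →L[ℝ] E4) - ((Q t₀ : E4 ≃L[ℝ] E4) : E4 →L[ℝ] E4)‖ ≤ δ)
    (hmis : Tendsto (fun t ↦ deriv (ξ i) t - ((((Λ i t : E4 ≃L[ℝ] E4) (E4.basisVector 0)) 0)⁻¹ •
      E4.spatial ((Λ i t : E4 ≃L[ℝ] E4) (E4.basisVector 0)))) atTop (𝓝 0))
    (hneg : ∀ t, ((Λ i t : E4 ≃L[ℝ] E4) (E4.basisVector 0)) 0 < 0)
    (hsep : ∀ j, j ≠ i → Tendsto (fun t ↦ ‖ξ i t - ξ j t‖) atTop atTop)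
    (U : Opens E4) (Φ : U → 𝓢.carrier) (hΦ : ContMDiff 𝓘(ℝ, E4) (𝓡 4) ∞ Φ) {τ₀ : ℝ}
    (hU : {x : E4 | τ₀ < x 0 ∧ ∀ j, rin j < Kerr.radius (a j) (poincareInv (Λ j (x 0))
      (E4.ofTimeSpace (x 0) (ξ j (x 0))) x)} ⊆ (U : Set E4))
    {k : ℕ} (hdev : Tendsto (fun t ↦ 𝓢.deviationCk ⟨U, fun x ↦ Minkowski.bilin +
      ∑ j, (boostedKerrBilin (Λ j (x 0)) (E4.ofTimeSpace (x 0) (ξ j (x 0))) (M j) (a j) x -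
        Minkowski.bilin), fun x ↦ x 0, E4.spatialNorm⟩ Φ k t) atTop (𝓝 0))
    {TO : ℝ}
    (hOfut : ∀ x : U, TO < x.1 0 → (∀ j, rin j < Kerr.radius (a j) (poincareInv (Λ j (x.1 0))
      (E4.ofTimeSpace (x.1 0) (ξ j (x.1 0))) x.1)) → ∀ w : E4, 0 < w 0 →
      𝓢.metric.val (Φ x) (mfderiv 𝓘(ℝ, E4) (𝓡 4) Φ x w) (mfderiv 𝓘(ℝ, E4) (𝓡 4) Φ x w) < 0 →
        𝓢.timeOrientation.IsFutureDirected (mfderiv 𝓘(ℝ, E4) (𝓡 4) Φ x w))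
    (Tlate : ℝ) :
    ∃ (xs : ℝ → E4) (hxsU : ∀ σ, xs σ ∈ (U : Set E4)),
      𝓢.metric.IsFutureCausalCurveOn 𝓢.timeOrientation (fun σ ↦ Φ ⟨xs σ, hxsU σ⟩) (Icc 0 1) ∧
      (∀ σ, Tlate < xs σ 0 ∧
        (∀ j, rin j < Kerr.radius (a j) (poincareInv (Λ j (xs σ 0))
          (E4.ofTimeSpace (xs σ 0) (ξ j (xs σ 0))) (xs σ))) ∧
        ∀ j, j ≠ i → K j < Kerr.radius (a j) (poincareInv (Λ j (xs σ 0))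
          (E4.ofTimeSpace (xs σ 0) (ξ j (xs σ 0))) (xs σ))) ∧
      Kerr.radius (a i) (poincareInv (Λ i (xs 0 0)) (E4.ofTimeSpace (xs 0 0) (ξ i (xs 0 0))) (xs 0)) <
        Kerr.rPlus (M i) (a i) ∧
      Kerr.rPlus (M i) (a i) < Kerr.radius (a i) (poincareInv (Λ i (xs 1 0))
        (E4.ofTimeSpace (xs 1 0) (ξ i (xs 1 0))) (xs 1)) := by
  -- ### the lab background
  set B : ModelBackground := ⟨U, fun x ↦ Minkowski.bilin +
      ∑ j, (boostedKerrBilin (Λ j (x 0)) (E4.ofTimeSpace (x 0) (ξ j (x 0))) (M j) (a j) x -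
        Minkowski.bilin), fun x ↦ x 0, E4.spatialNorm⟩ with hB
  -- ### constants
  set Mi : ℝ := M i with hMi
  set ai : ℝ := a i with hai
  set rp : ℝ := Kerr.rPlus Mi ai with hrp
  have hMrp : Mi ≤ rp := le_rPlus_self Mi ai
  have hrp0 : 0 < rp := by rw [hMi] at hMrp; linarith
  have hrin' : rin i < rp := hrin
  set θ : ℝ := min (rp / 40) ((rp - rin i) / 6) with hθ
  have hθ0 : 0 < θ := escape_theta_pos_spin hrp0 hrin'
  have hθrp : θ ≤ rp / 40 := min_le_left _ _
  have hθr : θ ≤ (rp - rin i) / 6 := min_le_right _ _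
  set ρ : ℝ := rp - θ with hρ
  have hρ0 : 0 < ρ := by rw [hρ]; linarith
  have hρ4 : 8 * θ / 2 < ρ := by rw [hρ]; linarith
  -- frames: norms and the inverse pair
  have hγ0 : 0 ≤ γ := (abs_nonneg _).trans (hγb i 0)
  set Γ : ℝ := 1 + 3 * γ with hΓ
  have hΓ1 : 1 ≤ Γ := by rw [hΓ]; linarith
  have hQγ : ∀ t, |((Q t : E4 ≃L[ℝ] E4) (E4.basisVector 0)) 0| ≤ γ := fun t ↦ by
    rw [hQ0]; exact hγb i t
  have hQpair : ∀ t, (((Q t : E4 ≃L[ℝ] E4).symm : E4 ≃L[ℝ] E4) : E4 →L[ℝ] E4).comp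
      ((Q t : E4 ≃L[ℝ] E4) : E4 →L[ℝ] E4) = 1 ∧
      ((Q t : E4 ≃L[ℝ] E4) : E4 →L[ℝ] E4).comp (((Q t : E4 ≃L[ℝ] E4).symm : E4 ≃L[ℝ] E4) : E4 →L[ℝ] E4) = 1 ∧
      ‖(((Q t : E4 ≃L[ℝ] E4).symm : E4 ≃L[ℝ] E4) : E4 →L[ℝ] E4)‖ ≤ Γ ∧
      ‖((Q t : E4 ≃L[ℝ] E4) : E4 →L[ℝ] E4)‖ ≤ Γ := fun t ↦ lorentz_inversePair (Q t) (hQγ t)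
  -- the rest escape direction and its lab bounds
  set w₀ : E4 := -E4.basisVector 0 + (1 / 2 : ℝ) • E4.basisVector 3 with hw₀
  have hw₀n : ‖w₀‖ ≤ 3 / 2 := norm_escapeDir_le
  set Wb : ℝ := (Γ * (3 / 2)) ^ 2 with hWb
  have hWb0 : 0 < Wb := by rw [hWb]; positivity
  have hW₀n : ∀ t, ‖(Q t : E4 ≃L[ℝ] E4) w₀‖ ≤ Γ * (3 / 2) := fun t ↦
    (((Q t : E4 ≃L[ℝ] E4) : E4 →L[ℝ] E4).le_opNorm w₀).trans
      (mul_le_mul (hQpair t).2.2.2 hw₀n (norm_nonneg _) (by linarith))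
  have hW₀sq : ∀ t, ‖(Q t : E4 ≃L[ℝ] E4) w₀‖ ^ 2 ≤ Wb := fun t ↦
    pow_le_pow_left₀ (norm_nonneg _) (hW₀n t) 2
  -- the window
  set Lw : ℝ := Γ * ρ + 12 * θ * Γ + 1 with hLw
  have hLw0 : 0 < Lw := by rw [hLw]; positivity
  -- ε and the margin
  set ε : ℝ := min (1 / 56) (θ / 2) with hε
  have hε0 : 0 < ε := lt_min (by norm_num) (by linarith)
  have hε56 : ε ≤ 1 / 56 := min_le_left _ _
  have hεθ : ε ≤ θ / 2 := min_le_right _ _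
  obtain ⟨δm, hδm, hmarg⟩ := exists_kerr_escape_margin Mi ai Γ ρ (8 * θ) Lw hρ4 hε0
  -- drift thresholds
  have hδQ : 0 < δm / (Γ ^ 2 + 1) := by positivity
  obtain ⟨Tq, hTq⟩ := hQdrift Lw _ hLw0 hδQ
  have hmisQ : Tendsto (fun t ↦ deriv (ξ i) t - ((((Q t : E4 ≃L[ℝ] E4) (E4.basisVector 0)) 0)⁻¹ •
      E4.spatial ((Q t : E4 ≃L[ℝ] E4) (E4.basisVector 0)))) atTop (𝓝 0) := by
    simp only [hQ0]; exact hmis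
  obtain ⟨Tc, hTc⟩ := exists_centre_drift_le hξd Q hmisQ (fun t ↦ (hQpair t).2.2.2) hLw0
    (fun δ hδ ↦ hQdrift Lw δ hLw0 hδ) hδm
  -- far field and separation
  obtain ⟨C, hC0, hfar⟩ := exists_farField_bound_spin (Γ := Γ) hΓ1
  have hΛinv : ∀ j, Continuous fun t : ℝ ↦ (((Λ j t : E4 ≃L[ℝ] E4).symm : E4 ≃L[ℝ] E4) : E4 →L[ℝ] E4) :=
    fun j ↦ continuous_lorentz_symm_of_continuous (hΛc j)
  have hΛb : ∀ j t, ‖(((Λ j t : E4 ≃L[ℝ] E4).symm : E4 ≃L[ℝ] E4) : E4 →L[ℝ] E4)‖ ≤ Γ :=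
    fun j t ↦ (norm_lorentz_symm_le' (Λ j t)).trans (by rw [hΓ]; linarith [hγb j t])
  set Dfar : ℝ := 1 + 2 * ∑ j, |a j| + 10 * (N + 1) * C * Wb * (∑ j, |M j| + 1) with hDfar
  have hsumM : 0 ≤ ∑ j, |M j| := Finset.sum_nonneg fun j _ ↦ abs_nonneg _
  have hsuma : 0 ≤ ∑ j, |a j| := Finset.sum_nonneg fun j _ ↦ abs_nonneg _
  have hDfar1 : ∀ j, max 1 (2 * |a j|) ≤ Dfar := by
    intro j
    have h1 : |a j| ≤ ∑ j, |a j| :=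
      Finset.single_le_sum (f := fun j ↦ |a j|) (fun j _ ↦ abs_nonneg _) (Finset.mem_univ j)
    have h2 : 0 ≤ 10 * ((N : ℝ) + 1) * C * Wb * (∑ j, |M j| + 1) := by positivity
    rw [hDfar]
    exact max_le (by linarith [abs_nonneg (a j)]) (by linarith)
  have hDfarpos : 0 < Dfar := lt_of_lt_of_le one_pos ((le_max_left _ _).trans (hDfar1 i))
  have hDfarM : ∀ j, 10 * (N + 1) * (|M j| * C * Wb) ≤ Dfar := by
    intro j
    rw [hDfar]
    have h1 : |M j| ≤ ∑ j, |M j| + 1 := by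
      have := Finset.single_le_sum (f := fun j ↦ |M j|) (fun j _ ↦ abs_nonneg _) (Finset.mem_univ j)
      linarith
    have h2 : 0 ≤ 10 * ((N : ℝ) + 1) * C * Wb := by positivity
    nlinarith
  set Zb : ℝ := Γ * (8 * θ + Lw + (ρ + 4 * θ)) with hZb
  have hZb0 : 0 ≤ Zb := by rw [hZb]; positivity
  have hsep' : ∀ j, ∃ Ts : ℝ, j ≠ i → ∀ t, Ts ≤ t →
      Dfar + Zb + δm + |K j| + |rin j| + |a j| + 1 ≤ ‖ξ i t - ξ j t‖ := by
    intro j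
    by_cases hj : j = i
    · exact ⟨0, fun h ↦ (h hj).elim⟩
    · obtain ⟨Ts, hTs⟩ := eventually_atTop.1 (tendsto_atTop.1 (hsep j hj)
        (Dfar + Zb + δm + |K j| + |rin j| + |a j| + 1))
      exact ⟨Ts, fun _ t ht ↦ hTs t ht⟩
  choose Ts hTs using hsep'
  -- deviation threshold
  set cdev : ℝ := 1 / (40 * (Wb + 1)) with hcdev
  have hcdev0 : 0 < cdev := by rw [hcdev]; positivity
  obtain ⟨Tdv, hTdv⟩ := (ENNReal.tendsto_atTop_zero.mp hdev) (ENNReal.ofReal cdev)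
    (ENNReal.ofReal_pos.mpr hcdev0)
  -- ### the base time
  set t₀ : ℝ := |Tlate| + |τ₀| + |TO| + |Tq| + |Tc| + |Tdv| + ∑ j, |Ts j| + 2 * Lw + 1 with ht₀
  have hTsj : ∀ j, Ts j ≤ ∑ j, |Ts j| := fun j ↦ (le_abs_self _).trans
    (Finset.single_le_sum (f := fun j ↦ |Ts j|) (fun j _ ↦ abs_nonneg _) (Finset.mem_univ j))
  have ht₀ge : ∀ T : ℝ, t₀ - Lw ≤ T → Tlate < T ∧ τ₀ < T ∧ TO < T ∧ Tq ≤ t₀ ∧ Tc ≤ t₀ ∧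
      Tdv ≤ T ∧ ∀ j, Ts j ≤ T := by
    intro T hT
    have h0 : 0 ≤ ∑ j, |Ts j| := Finset.sum_nonneg fun j _ ↦ abs_nonneg _
    have := le_abs_self Tlate; have := le_abs_self τ₀; have := le_abs_self TO
    have := le_abs_self Tq; have := le_abs_self Tc; have := le_abs_self Tdv
    have := abs_nonneg Tlate; have := abs_nonneg τ₀; have := abs_nonneg TO
    have := abs_nonneg Tq; have := abs_nonneg Tc; have := abs_nonneg Tdv
    refine ⟨by linarith, by linarith, by linarith, by linarith, by linarith, by linarith,
      fun j ↦ (hTsj j).trans (by linarith)⟩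
  -- ### the frozen frame at `t₀` and the segment
  set Λ₀ : lorentzGroup := Q t₀ with hΛ₀
  set W₀ : E4 := (Λ₀ : E4 ≃L[ℝ] E4) w₀ with hW₀
  have hW0pos : 0 < W₀ 0 := by
    rw [hW₀, hw₀]
    exact lorentz_escapeDir_apply_zero_pos Λ₀ (by rw [hΛ₀, hQ0]; exact hneg t₀)
  have hW₀b : ‖W₀‖ ≤ Γ * (3 / 2) := hW₀n t₀
  have hW₀0le : W₀ 0 ≤ Γ * (3 / 2) := (le_abs_self _).trans ((C0Extension.abs_apply_zero_le_norm W₀).trans hW₀b)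
  set b₀ : E4 := ρ • E4.basisVector 3 with hb₀
  set c₁ : ℝ := 16 * θ / Real.pi with hc₁
  have hc₁0 : 0 < c₁ := by rw [hc₁]; positivity
  set xc : E4 := E4.ofTimeSpace t₀ (ξ i t₀) + (Λ₀ : E4 ≃L[ℝ] E4) b₀ with hxc
  set xs : ℝ → E4 := fun σ ↦ xc + (c₁ * Real.arctan σ) • W₀ with hxs
  -- the parameter `s = c₁ arctan σ ∈ [−8θ, 8θ]`
  have hsmem : ∀ σ, c₁ * Real.arctan σ ∈ Icc (-(8 * θ)) (8 * θ) := fun σ ↦ by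
    have h := (arctan_scale_bounds hθ0 σ).2
    rw [← hc₁] at h
    exact ⟨(abs_le.mp h).1, (abs_le.mp h).2⟩
  have hb₀0 : |((Λ₀ : E4 ≃L[ℝ] E4) b₀) 0| ≤ Γ * ρ := by
    refine (C0Extension.abs_apply_zero_le_norm _).trans ((((Λ₀ : E4 ≃L[ℝ] E4) : E4 →L[ℝ] E4).le_opNorm b₀).trans ?_)
    rw [hb₀, norm_smul, PiLp.norm_single, norm_one, mul_one, Real.norm_eq_abs, abs_of_pos hρ0]
    exact mul_le_mul_of_nonneg_right (hQpair t₀).2.2.2 hρ0.le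
  have hT : ∀ σ, xs σ 0 = t₀ + ((Λ₀ : E4 ≃L[ℝ] E4) b₀) 0 + (c₁ * Real.arctan σ) * W₀ 0 := by
    intro σ
    simp only [hxs, hxc, PiLp.add_apply, PiLp.smul_apply, smul_eq_mul, E4.ofTimeSpace_apply_zero]
  have hTwin : ∀ σ, |xs σ 0 - t₀| ≤ Lw := by
    intro σ
    rw [hT σ, show t₀ + ((Λ₀ : E4 ≃L[ℝ] E4) b₀) 0 + c₁ * Real.arctan σ * W₀ 0 - t₀ =
      ((Λ₀ : E4 ≃L[ℝ] E4) b₀) 0 + c₁ * Real.arctan σ * W₀ 0 by ring]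
    have h1 : |c₁ * Real.arctan σ * W₀ 0| ≤ 8 * θ * (Γ * (3 / 2)) := by
      rw [abs_mul, abs_of_pos hW0pos]
      exact mul_le_mul (abs_le.mpr (hsmem σ)) hW₀0le hW0pos.le (by positivity)
    calc |((Λ₀ : E4 ≃L[ℝ] E4) b₀) 0 + c₁ * Real.arctan σ * W₀ 0|
        ≤ |((Λ₀ : E4 ≃L[ℝ] E4) b₀) 0| + |c₁ * Real.arctan σ * W₀ 0| := abs_add_le _ _
      _ ≤ Lw := by rw [hLw]; linarith
  have hlate : ∀ σ, t₀ - Lw ≤ xs σ 0 := fun σ ↦ by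
    have := (abs_le.mp (hTwin σ)).1; linarith
  -- the value bound `M r/(2(r² + a²)) ≤ 4/7` across the segment
  have hval47 : ∀ s ∈ Icc (-(8 * θ)) (8 * θ), Mi * (ρ + s / 2) / (2 * ((ρ + s / 2) ^ 2 + ai ^ 2)) ≤ 4 / 7 := by
    intro s hs
    have hr0 : 0 < rp - 5 * θ := by linarith
    have hle : rp - 5 * θ ≤ ρ + s / 2 := by rw [hρ]; linarith [hs.1]
    have h1 := axis_value_le hM.le hr0 hle ai
    have h2 : Mi / (2 * (rp - 5 * θ)) ≤ 4 / 7 := by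
      rw [div_le_div_iff₀ (by positivity) (by norm_num)]; nlinarith
    exact h1.trans h2
  -- ### the main estimate at the points of the segment
  have hmain : ∀ σ,
      |Kerr.radius ai (poincareInv (Λ i (xs σ 0)) (E4.ofTimeSpace (xs σ 0) (ξ i (xs σ 0))) (xs σ)) -
          (ρ + c₁ * Real.arctan σ / 2)| < ε ∧
        boostedKerrBilin (Λ i (xs σ 0)) (E4.ofTimeSpace (xs σ 0) (ξ i (xs σ 0))) Mi ai (xs σ) W₀ W₀ <
          -(3 / 4) + 4 / 7 + ε ∧
        ‖E4.spatial (xs σ) - ξ i (xs σ 0)‖ ≤ Zb + δm := by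
    intro σ
    obtain ⟨-, -, -, hTqt, hTct, -, -⟩ := ht₀ge (xs σ 0) (hlate σ)
    have hΓ0 : 0 ≤ Γ := by linarith
    have hdq : ‖((Q (xs σ 0) : E4 ≃L[ℝ] E4) : E4 →L[ℝ] E4) - ((Λ₀ : E4 ≃L[ℝ] E4) : E4 →L[ℝ] E4)‖ ≤
        δm / (Γ ^ 2 + 1) := by rw [hΛ₀]; exact hTq t₀ (xs σ 0) hTqt (hTwin σ)
    have hdξ := hTc t₀ (xs σ 0) hTct (hTwin σ)
    rw [← hΛ₀] at hdξ
    obtain ⟨hR, hV, hdist⟩ := escape_point_estimate Mi ai Γ ρ θ Lw ε δm hΓ0 hρ0.le hmarg Λ₀ (Q (xs σ 0))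
      (Λ i (xs σ 0)) (hQpair t₀) (hQpair (xs σ 0)).2.2.1 (hQbil (xs σ 0)) (hQrad (xs σ 0))
      (ξ i t₀) (ξ i (xs σ 0)) (x := xs σ) (by simp only [hxs, hxc, hW₀, hb₀, hw₀]) rfl (hsmem σ)
      (hTwin σ) hdq hdξ
    refine ⟨hR, ?_, by rw [hZb]; exact hdist⟩
    have h47 := hval47 _ (hsmem σ)
    rw [hW₀, hw₀]
    linarith
  -- radii: hole `i` and the other holes
  have hri : ∀ σ, rin i < Kerr.radius ai (poincareInv (Λ i (xs σ 0))
      (E4.ofTimeSpace (xs σ 0) (ξ i (xs σ 0))) (xs σ)) := by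
    intro σ
    obtain ⟨hR, -, -⟩ := hmain σ
    have := (abs_lt.mp hR).1
    have := (hsmem σ).1
    linarith
  have hrj : ∀ σ j, j ≠ i → Dfar ≤ ‖E4.spatial (xs σ) - ξ j (xs σ 0)‖ ∧
      K j < Kerr.radius (a j) (poincareInv (Λ j (xs σ 0)) (E4.ofTimeSpace (xs σ 0) (ξ j (xs σ 0))) (xs σ)) ∧
      rin j < Kerr.radius (a j) (poincareInv (Λ j (xs σ 0)) (E4.ofTimeSpace (xs σ 0) (ξ j (xs σ 0))) (xs σ)) := by
    intro σ j hj
    obtain ⟨-, -, hdist⟩ := hmain σ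
    obtain ⟨-, -, -, -, -, -, hTsT⟩ := ht₀ge (xs σ 0) (hlate σ)
    have hsepT := hTs j hj (xs σ 0) (hTsT j)
    have htri : ‖ξ i (xs σ 0) - ξ j (xs σ 0)‖ ≤ ‖E4.spatial (xs σ) - ξ i (xs σ 0)‖ +
        ‖E4.spatial (xs σ) - ξ j (xs σ 0)‖ := by
      rw [← norm_neg (E4.spatial (xs σ) - ξ i (xs σ 0))]
      have := norm_add_le (-(E4.spatial (xs σ) - ξ i (xs σ 0))) (E4.spatial (xs σ) - ξ j (xs σ 0))
      rwa [show -(E4.spatial (xs σ) - ξ i (xs σ 0)) + (E4.spatial (xs σ) - ξ j (xs σ 0)) =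
        ξ i (xs σ 0) - ξ j (xs σ 0) by abel] at this
    have hD : Dfar + |K j| + |rin j| + |a j| + 1 ≤ ‖E4.spatial (xs σ) - ξ j (xs σ 0)‖ := by linarith
    have hrad : ‖E4.spatial (xs σ) - ξ j (xs σ 0)‖ - |a j| ≤ Kerr.radius (a j) (poincareInv (Λ j (xs σ 0))
        (E4.ofTimeSpace (xs σ 0) (ξ j (xs σ 0))) (xs σ)) :=
      norm_sub_abs_le_radius_poincareInv (Λ j (xs σ 0)) (a j) (xs σ 0) (ξ j (xs σ 0)) rfl
    refine ⟨by linarith [abs_nonneg (K j), abs_nonneg (rin j), abs_nonneg (a j)], ?_, ?_⟩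
    · linarith [le_abs_self (K j), abs_nonneg (rin j)]
    · linarith [le_abs_self (rin j), abs_nonneg (K j)]
  have hguar : ∀ σ j, rin j < Kerr.radius (a j) (poincareInv (Λ j (xs σ 0))
      (E4.ofTimeSpace (xs σ 0) (ξ j (xs σ 0))) (xs σ)) := by
    intro σ j
    by_cases hj : j = i
    · subst hj; exact hri σ
    · exact (hrj σ j hj).2.2
  have hxsU : ∀ σ, xs σ ∈ (U : Set E4) := fun σ ↦
    hU ⟨(ht₀ge _ (hlate σ)).2.1, hguar σ⟩
  -- the model value at the points of the segment
  have hbil : ∀ σ, B.bilin (xs σ) W₀ W₀ ≤ -(1 / 20) := by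
    intro σ
    show (Minkowski.bilin + ∑ j, (boostedKerrBilin (Λ j (xs σ 0))
      (E4.ofTimeSpace (xs σ 0) (ξ j (xs σ 0))) (M j) (a j) (xs σ) - Minkowski.bilin)) W₀ W₀ ≤ -(1 / 20)
    obtain ⟨-, hval, -⟩ := hmain σ
    set f : Fin N → ℝ := fun j ↦ (boostedKerrBilin (Λ j (xs σ 0))
      (E4.ofTimeSpace (xs σ 0) (ξ j (xs σ 0))) (M j) (a j) (xs σ) - Minkowski.bilin) W₀ W₀ with hf
    have hexp : (Minkowski.bilin + ∑ j, (boostedKerrBilin (Λ j (xs σ 0))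
        (E4.ofTimeSpace (xs σ 0) (ξ j (xs σ 0))) (M j) (a j) (xs σ) - Minkowski.bilin)) W₀ W₀ =
        Minkowski.bilin W₀ W₀ + ∑ j, f j := by
      simp only [hf, FunLike.coe_add, FunLike.coe_sum, Pi.add_apply, Finset.sum_apply]
    have hsplit : ∑ j, f j = f i + ∑ j ∈ Finset.univ.erase i, f j :=
      (Finset.add_sum_erase _ _ (Finset.mem_univ i)).symm
    have hfi : f i = boostedKerrBilin (Λ i (xs σ 0)) (E4.ofTimeSpace (xs σ 0) (ξ i (xs σ 0))) Mi ai
        (xs σ) W₀ W₀ - Minkowski.bilin W₀ W₀ := by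
      simp only [hf, FunLike.coe_sub, Pi.sub_apply, hMi, hai]
    have hηW : Minkowski.bilin W₀ W₀ = -(3 / 4) := by
      rw [hW₀, Λ₀.2 w₀ w₀, hw₀]; exact minkowski_escapeDir
    -- the other holes contribute little
    have hfar' : ∀ j, j ≠ i → |f j| ≤ 1 / (10 * (N + 1)) := by
      intro j hj
      obtain ⟨hD, -, -⟩ := hrj σ j hj
      have hD0 : 0 < ‖E4.spatial (xs σ) - ξ j (xs σ 0)‖ := by linarith
      have h1 := hfar (M j) (a j) (Λ j) (ξ j) (xs σ 0) (xs σ) (hΛinv j) (hξc j) (hΛb j) rfl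
        ((hDfar1 j).trans hD)
      have h2 : |f j| ≤ ‖boostedKerrBilin (Λ j (xs σ 0)) (E4.ofTimeSpace (xs σ 0) (ξ j (xs σ 0)))
          (M j) (a j) (xs σ) - Minkowski.bilin‖ * ‖W₀‖ * ‖W₀‖ := abs_apply_self_le_opNorm _ _
      have h3 : ‖boostedKerrBilin (Λ j (xs σ 0)) (E4.ofTimeSpace (xs σ 0) (ξ j (xs σ 0))) (M j) (a j)
          (xs σ) - Minkowski.bilin‖ * ‖W₀‖ * ‖W₀‖ ≤ |M j| * C / Dfar * Wb := by
        have h4 : |M j| * C / ‖E4.spatial (xs σ) - ξ j (xs σ 0)‖ ≤ |M j| * C / Dfar :=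
          div_le_div_of_nonneg_left (by positivity) hDfarpos hD
        rw [mul_assoc]
        refine mul_le_mul (h1.trans h4) ?_ (by positivity) (by positivity)
        rw [← pow_two]; exact hW₀sq t₀
      have h5 : |M j| * C / Dfar * Wb ≤ 1 / (10 * (N + 1)) := by
        rw [show |M j| * C / Dfar * Wb = (|M j| * C * Wb) / Dfar by ring,
          div_le_div_iff₀ hDfarpos (by positivity)]
        have := hDfarM j
        nlinarith
      exact h2.trans (h3.trans h5)
    have hsum : ∑ j ∈ Finset.univ.erase i, f j ≤ 1 / 10 := sum_erase_le_tenth i f hfar'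
    rw [hexp, hsplit, hfi, hηW]
    linarith
  -- the deviation at the points of the segment
  have hdevpt : ∀ σ, ‖𝓢.deviation B Φ ⟨xs σ, hxsU σ⟩‖ ≤ cdev := by
    intro σ
    obtain ⟨-, -, -, -, -, hTdvT, -⟩ := ht₀ge (xs σ 0) (hlate σ)
    have h1 : 𝓢.deviationCk B Φ k (B.time (xs σ)) ≤ ENNReal.ofReal cdev := hTdv _ hTdvT
    exact norm_deviation_le_of_deviationCk_le 𝓢 B Φ k hcdev0.le ⟨xs σ, hxsU σ⟩ h1
  have hcW : cdev * ‖W₀‖ ^ 2 < 1 / 20 := by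
    have h1 : cdev * ‖W₀‖ ^ 2 ≤ cdev * Wb := mul_le_mul_of_nonneg_left (hW₀sq t₀) hcdev0.le
    have h2 : cdev * Wb < 1 / 20 := by
      rw [hcdev, one_div, inv_mul_eq_div, div_lt_div_iff₀ (by positivity) (by norm_num)]
      nlinarith
    exact h1.trans_lt h2
  -- ### the curve
  have hcurve : 𝓢.metric.IsFutureCausalCurveOn 𝓢.timeOrientation (fun σ ↦ Φ ⟨xs σ, hxsU σ⟩)
      (Icc 0 1) :=
    isFutureCausalCurveOn_segment B Φ hΦ
      (fun y : U ↦ TO < y.1 0 ∧ ∀ j, rin j < Kerr.radius (a j) (poincareInv (Λ j (y.1 0))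
        (E4.ofTimeSpace (y.1 0) (ξ j (y.1 0))) y.1))
      (fun y hQ w hw hg ↦ hOfut y hQ.1 hQ.2 w hw hg) xc W₀ (m := 1 / 20) (c := cdev) hc₁0 hW0pos hxsU
      (fun σ ↦ ⟨(ht₀ge (xs σ 0) (hlate σ)).2.2.1, hguar σ⟩) hbil hcW hdevpt
  -- ### endpoints and conclusion
  refine ⟨xs, hxsU, hcurve, fun σ ↦ ⟨(ht₀ge _ (hlate σ)).1, hguar σ, fun j hj ↦ (hrj σ j hj).2.1⟩,
    ?_, ?_⟩
  · obtain ⟨hR, -, -⟩ := hmain 0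
    rw [Real.arctan_zero, mul_zero, zero_div, add_zero] at hR
    have := (abs_lt.mp hR).2
    show _ < rp
    linarith
  · obtain ⟨hR, -, -⟩ := hmain 1
    rw [Real.arctan_one] at hR
    have hc : c₁ * (Real.pi / 4) = 4 * θ := by rw [hc₁]; field_simp; ring
    rw [hc] at hR
    have := (abs_lt.mp hR).1
    show rp < _
    linarith

end Escape

/-- The horizon radius of a hole of positive mass is positive (registered stub
`rPlus_pos_of_pos_rechart` of the crux item). [folklore] -/
theorem rPlus_pos_of_pos_rechart : ∀ {M : ℝ} (a : ℝ), 0 < M → 0 < Kerr.rPlus M a :=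
  fun a hM ↦ hM.trans_le (le_rPlus_self _ a)

end Summit.FinalStateConjecture.FinalStateConjecture.Theorems
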